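import Summits.HodgeConjecture.HodgeConjecture.Theorems.TropicalWeilObstructionTropicalWeilVanishingFrameSpanRank
import Summits.HodgeConjecture.HodgeConjecture.Theorems.TropicalWeilObstructionTropicalWeilVanishingIdentityCriterion
import HarnessLib

/-!
# Route `TropicalWeilObstruction` (Kontsevich's tropical test — NEGATION SINK, exploration, no summit claim):
# the frame span of an effective tropical `4`-cycle on a very general tropical Weil eightfold — IV. seeds at the identity

Negation-sink bookkeeping of the cell `pub-hodge-tropical` (seat tropical-1 gen 6); part IV of four. By the decision
criterion (p330167) every refutation of the open crux K1 (`TropicalWeilVanishing`, stmt-HodgeConjecture-18478) runs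
through a SEED: an effective tropical `4`-cycle `Z₀` on the standard torus `ℝ⁸/ℤ⁸` with `W(Z₀) ≠ 0` whose combinatorial
type is linearly realisable in every direction of `Sym_J` (the unobstructed alternative of the dichotomy
`obstructed_or_linearSection`, p313252). Here:

* `exists_generic_realisation_of_linearlyRealisable` — such a type (same cells, weights, FRAMES, facet data) is
  realised by an effective cycle over a very general positive definite `J`-commuting period (`linearSpread` +
  `exists_weilGeneric_mem_of_open`, the argument of p314377 without the `W ≠ 0` clause);
* `finrank_span_frames_ge_of_linearlyRealisable`, `numCells_ge_of_linearlyRealisable` — so its Plücker vectors span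
  `≥ 69` dimensions: a seed has `≥ 69` cells in `≥ 69` pairwise distinct rational `4`-planes;
* `obstructed_of_finrank_span_frames_le`, `obstructed_of_card_image_pluckerCoord_le`, `obstructed_of_numCells_le` — contrapositive, a RUNG of the registered
  stub `stub_nonflatObstructedAtIdentity` (line `identity_transfer`): every non-empty effective type on `ℝ⁸/ℤ⁸` with
  at most `68` distinct Plücker vectors (e.g. at most `68` cells) is OBSTRUCTED AT THE IDENTITY, with no hypothesis on
  `W` or flatness — the fourth landed obstruction mechanism (after flatness, plane-pure loops, component rigidity) and
  the first pure size condition. Consequently bounded seed searches over few planes (idea card `identity-seeds`: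
  "≤ 8 planes") are empty for free, and the "naive" types of the census (Kuhn subtori, products, small designs) are
  obstructed for this one reason;
* `tropicalWeilVanishing_iff_obstructed_of_large` — hence K1 ⟺ every `W ≠ 0` seed with frame span of rank `≥ 69` is
  obstructed (p314377 with the small types discharged): the open content of K1 lives on types with `≥ 69` planes.

HONEST STATUS. It bounds the size of seeds; it decides nothing about K1 or about the Hodge conjecture.
No definition, no named fact, no sorry.

References: [Zharkov2020TropicalWeil] I. Zharkov, arXiv:2002.02347, §1–2 (pp. 2–4); [MikhalkinZharkov2014Eigenwave]
G. Mikhalkin, I. Zharkov, LN UMI 15 (2014), Def. 4.2, Prop. 4.3.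
-/

set_option linter.dupNamespace false

noncomputable section

open scoped BigOperators
open Matrix
open Literature.AlgebraicGeometry.Tropical

namespace Summit.HodgeConjecture.HodgeConjecture.Theorems.TropicalWeilVanishing.FrameSpan

/-! ## §6 Seeds at the identity: unobstructed types obey the same bound -/

/-- **Transport of a linearly realisable type to a very general period.** If the combinatorial type of an effective
tropical `4`-cycle `Z₀` on the standard torus `ℝ⁸/ℤ⁸` is linearly realisable in every direction of `Sym_J` (the
UNOBSTRUCTED alternative of the dichotomy `obstructed_or_linearSection`, p313252), then the type — same number of cells,
same weights, SAME FRAMES, same facet data — is realised by an effective cycle over some very general positive definite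
`J`-commuting period (`linearSpread` + `exists_weilGeneric_mem_of_open`, the argument of p314377 without the `W ≠ 0` clause).
[cite: Zharkov2020TropicalWeil, §1–2 (pp. 2–4)] [cite: MikhalkinZharkov2014Eigenwave, Def. 4.2 and Prop. 4.3] -/
theorem exists_generic_realisation_of_linearlyRealisable
    (Z₀ : TropicalTorusCycle (2 * 4) 4 (1 : Matrix (Fin (2 * 4)) (Fin (2 * 4)) ℝ))
    (hsec : ∀ D : Matrix (Fin (2 * 4)) (Fin (2 * 4)) ℝ, D.IsSymm → D * weilJ 4 = weilJ 4 * D →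
      ∃ (v : Fin Z₀.numCells → Fin (4 + 1) → Fin (2 * 4) → ℝ)
        (T : Fin Z₀.numCells → Matrix (Fin 4) (Fin 4) ℝ)
        (r : Fin Z₀.numFacetClasses → Fin 4 → Fin (2 * 4) → ℝ),
        (∀ (σ : Fin Z₀.numCells) (j : Fin 4) (a : Fin (2 * 4)),
            v σ j.succ a - v σ 0 a = ∑ m, ((Z₀.cell σ).frame a m : ℝ) * T σ m j) ∧
        (∀ (σ : Fin Z₀.numCells) (i : Fin (4 + 1)) (j : Fin 4) (a : Fin (2 * 4)),
            v σ (i.succAbove (Z₀.facetPerm σ i j)) a =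
              r (Z₀.facetClass σ i) j a + ∑ b, D a b * (Z₀.facetShift σ i b : ℝ))) :
    ∃ (Q : Matrix (Fin (2 * 4)) (Fin (2 * 4)) ℝ) (Z : TropicalTorusCycle (2 * 4) 4 Q),
      Q.PosDef ∧ Q * weilJ 4 = weilJ 4 * Q ∧ IsWeilGeneric 4 Q ∧
      ∃ hc : Z.numCells = Z₀.numCells, ∀ σ : Fin Z.numCells,
        (Z.cell σ).frame = (Z₀.cell (Fin.cast hc σ)).frame ∧ (Z.cell σ).weight = (Z₀.cell (Fin.cast hc σ)).weight := by
  have h1S : (1 : Matrix (Fin (2 * 4)) (Fin (2 * 4)) ℝ).IsSymm := Matrix.isSymm_one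
  have h1J : (1 : Matrix (Fin (2 * 4)) (Fin (2 * 4)) ℝ) * weilJ 4 = weilJ 4 * 1 := by
    rw [Matrix.one_mul, Matrix.mul_one]
  obtain ⟨V, T, Rf, hTcont, hT1, hreal⟩ := linearSpread h1S h1J Z₀ hsec
  set U : Set (Matrix (Fin (2 * 4)) (Fin (2 * 4)) ℝ) := {P | ∀ σ, 0 < (T P σ).det} with hU
  have hUopen : IsOpen U := by
    rw [hU, Set.setOf_forall]
    exact isOpen_iInter_of_finite fun σ => isOpen_lt continuous_const (hTcont σ).matrix_det
  have h1U : (1 : Matrix (Fin (2 * 4)) (Fin (2 * 4)) ℝ) ∈ U := fun σ => by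
    rw [hT1 σ]; exact (Z₀.cell σ).edgeCoeff_det_pos
  obtain ⟨Q, hQU, hQ, hQJ, hgen⟩ := exists_weilGeneric_mem_of_open U hUopen h1U
  have hQS : Q.IsSymm := by
    have h := hQ.1
    rw [Matrix.IsHermitian, Matrix.conjTranspose_eq_transpose_of_trivial] at h
    exact h
  obtain ⟨hv, hfe⟩ := hreal Q hQS hQJ
  refine ⟨Q,
    { numCells := Z₀.numCells
      cell := fun σ =>
        { weight := (Z₀.cell σ).weight
          weight_pos := (Z₀.cell σ).weight_pos
          vertex := V Q σ
          frame := (Z₀.cell σ).frame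
          edgeCoeff := T Q σ
          vertex_succ_sub := hv σ
          edgeCoeff_det_pos := hQU σ
          frame_saturated := (Z₀.cell σ).frame_saturated }
      numFacetClasses := Z₀.numFacetClasses
      refFacet := Rf Q
      facetClass := Z₀.facetClass
      facetPerm := Z₀.facetPerm
      facetShift := Z₀.facetShift
      facet_eq := hfe
      balanced := Z₀.balanced }, hQ, hQJ, hgen, rfl, fun σ => ⟨rfl, rfl⟩⟩

/-- **SEED DIRECTION BOUND.** Let `Z₀` be a non-empty effective tropical `4`-cycle on the standard torus `ℝ⁸/ℤ⁸`
whose combinatorial type is LINEARLY REALISABLE in every direction of `Sym_J` — by the decision criterion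
`not_tropicalWeilVanishing_iff_exists_unobstructedSeed` (p330167) every refutation of the open crux K1 runs through
such a seed (with `W(Z₀) ≠ 0`). Then the Plücker vectors of its cells span a subspace of dimension `≥ 69`: the seed has
at least `69` cells lying in at least `69` pairwise distinct rational `4`-planes. Consequently every bounded search over
seeds glued from few planes (e.g. the `≤ 8 planes` enumeration of idea card `identity-seeds`) is EMPTY for free, and all
"naive" types of the census (Kuhn subtori, products, designs on a handful of planes) are obstructed for this one reason.
Nothing here decides K1. [cite: Zharkov2020TropicalWeil, §1–2 (pp. 2–4)] [cite: MikhalkinZharkov2014Eigenwave, Def. 4.2 and Prop. 4.3] -/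
theorem finrank_span_frames_ge_of_linearlyRealisable
    (Z₀ : TropicalTorusCycle (2 * 4) 4 (1 : Matrix (Fin (2 * 4)) (Fin (2 * 4)) ℝ)) (hZ₀ : 0 < Z₀.numCells)
    (hsec : ∀ D : Matrix (Fin (2 * 4)) (Fin (2 * 4)) ℝ, D.IsSymm → D * weilJ 4 = weilJ 4 * D →
      ∃ (v : Fin Z₀.numCells → Fin (4 + 1) → Fin (2 * 4) → ℝ)
        (T : Fin Z₀.numCells → Matrix (Fin 4) (Fin 4) ℝ)
        (r : Fin Z₀.numFacetClasses → Fin 4 → Fin (2 * 4) → ℝ),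
        (∀ (σ : Fin Z₀.numCells) (j : Fin 4) (a : Fin (2 * 4)),
            v σ j.succ a - v σ 0 a = ∑ m, ((Z₀.cell σ).frame a m : ℝ) * T σ m j) ∧
        (∀ (σ : Fin Z₀.numCells) (i : Fin (4 + 1)) (j : Fin 4) (a : Fin (2 * 4)),
            v σ (i.succAbove (Z₀.facetPerm σ i j)) a =
              r (Z₀.facetClass σ i) j a + ∑ b, D a b * (Z₀.facetShift σ i b : ℝ))) :
    69 ≤ Module.finrank ℝ (Submodule.span ℝ (Set.range fun σ : Fin Z₀.numCells =>
      fun S : Fin 4 → Fin (2 * 4) => ((pluckerCoord (Z₀.cell σ).frame S : ℤ) : ℝ))) := by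
  obtain ⟨Q, Z, hQ, hQJ, hgen, hc, hsame⟩ := exists_generic_realisation_of_linearlyRealisable Z₀ hsec
  have hZ : 0 < Z.numCells := by rw [hc]; exact hZ₀
  have h := finrank_span_frames_ge Q hQ hQJ hgen Z hZ
  have hrange : (Set.range fun σ : Fin Z.numCells => fun S : Fin 4 → Fin (2 * 4) =>
      ((pluckerCoord (Z.cell σ).frame S : ℤ) : ℝ)) =
      Set.range fun σ : Fin Z₀.numCells => fun S : Fin 4 → Fin (2 * 4) =>
        ((pluckerCoord (Z₀.cell σ).frame S : ℤ) : ℝ) := by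
    ext f
    constructor
    · rintro ⟨σ, rfl⟩
      refine ⟨Fin.cast hc σ, ?_⟩
      funext S
      simp only [(hsame σ).1]
    · rintro ⟨σ, rfl⟩
      refine ⟨Fin.cast hc.symm σ, ?_⟩
      have e : Fin.cast hc (Fin.cast hc.symm σ) = σ := Fin.ext rfl
      funext S
      simp only [(hsame (Fin.cast hc.symm σ)).1, e]
  rw [hrange] at h
  exact h

/-- **Seeds have at least `69` cells in at least `69` distinct `4`-planes.** [cite: Zharkov2020TropicalWeil, §1–2 (pp. 2–4)]
[cite: MikhalkinZharkov2014Eigenwave, Def. 4.2 and Prop. 4.3] -/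
theorem numCells_ge_of_linearlyRealisable
    (Z₀ : TropicalTorusCycle (2 * 4) 4 (1 : Matrix (Fin (2 * 4)) (Fin (2 * 4)) ℝ)) (hZ₀ : 0 < Z₀.numCells)
    (hsec : ∀ D : Matrix (Fin (2 * 4)) (Fin (2 * 4)) ℝ, D.IsSymm → D * weilJ 4 = weilJ 4 * D →
      ∃ (v : Fin Z₀.numCells → Fin (4 + 1) → Fin (2 * 4) → ℝ)
        (T : Fin Z₀.numCells → Matrix (Fin 4) (Fin 4) ℝ)
        (r : Fin Z₀.numFacetClasses → Fin 4 → Fin (2 * 4) → ℝ),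
        (∀ (σ : Fin Z₀.numCells) (j : Fin 4) (a : Fin (2 * 4)),
            v σ j.succ a - v σ 0 a = ∑ m, ((Z₀.cell σ).frame a m : ℝ) * T σ m j) ∧
        (∀ (σ : Fin Z₀.numCells) (i : Fin (4 + 1)) (j : Fin 4) (a : Fin (2 * 4)),
            v σ (i.succAbove (Z₀.facetPerm σ i j)) a =
              r (Z₀.facetClass σ i) j a + ∑ b, D a b * (Z₀.facetShift σ i b : ℝ))) :
    69 ≤ (Finset.univ.image fun σ : Fin Z₀.numCells => pluckerCoord (Z₀.cell σ).frame).card ∧ 69 ≤ Z₀.numCells := by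
  classical
  have h := finrank_span_frames_ge_of_linearlyRealisable Z₀ hZ₀ hsec
  set P : Fin Z₀.numCells → ((Fin 4 → Fin (2 * 4)) → ℝ) :=
    fun σ S => ((pluckerCoord (Z₀.cell σ).frame S : ℤ) : ℝ) with hP
  have h1 : Module.finrank ℝ (Submodule.span ℝ (Set.range P)) ≤ (Set.range P).toFinset.card :=
    finrank_span_le_card _
  rw [Set.toFinset_range] at h1
  have h2 : (Finset.univ.image P).card ≤
      (Finset.univ.image fun σ : Fin Z₀.numCells => pluckerCoord (Z₀.cell σ).frame).card := by
    have e : Finset.univ.image P = (Finset.univ.image fun σ : Fin Z₀.numCells => pluckerCoord (Z₀.cell σ).frame).image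
        (fun g : (Fin 4 → Fin (2 * 4)) → ℤ => fun S => ((g S : ℤ) : ℝ)) := by
      rw [Finset.image_image]
      rfl
    rw [e]
    exact Finset.card_image_le
  have h3 := Finset.card_image_le (s := (Finset.univ : Finset (Fin Z₀.numCells)))
    (f := fun σ : Fin Z₀.numCells => pluckerCoord (Z₀.cell σ).frame)
  simp only [Finset.card_univ, Fintype.card_fin] at h3
  exact ⟨by omega, by omega⟩

/-- **OBSTRUCTION BY DIRECTION COUNT** (a rung of `stub_nonflatObstructedAtIdentity`, line `identity_transfer`): an
effective tropical `4`-cycle `Z₀` on the standard torus `ℝ⁸/ℤ⁸` (non-empty) whose cells carry at most `68` pairwise distinct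
Plücker vectors is OBSTRUCTED AT THE IDENTITY — some linear functional on `8 × 8` matrices, non-zero on `Sym_J`, vanishes at
every symmetric `J`-commuting period over which the combinatorial type of `Z₀` realises (the first alternative of the
dichotomy `obstructed_or_linearSection`, p313252; no hypothesis on `W(Z₀)` or on flatness). This is the fourth landed
obstruction mechanism for the open crux K1 (after flatness/total reality, plane-pure incidence loops and component
rigidity), and the first that is a pure SIZE condition. It decides nothing about K1.
[cite: Zharkov2020TropicalWeil, §1–2 (pp. 2–4)] [cite: MikhalkinZharkov2014Eigenwave, Def. 4.2 and Prop. 4.3] -/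
theorem obstructed_of_card_image_pluckerCoord_le
    (Z₀ : TropicalTorusCycle (2 * 4) 4 (1 : Matrix (Fin (2 * 4)) (Fin (2 * 4)) ℝ)) (hZ₀ : 0 < Z₀.numCells)
    (hfew : (Finset.univ.image fun σ : Fin Z₀.numCells => pluckerCoord (Z₀.cell σ).frame).card ≤ 68) :
    ∃ ℓ : Matrix (Fin (2 * 4)) (Fin (2 * 4)) ℝ →ₗ[ℝ] ℝ,
      (∃ D : Matrix (Fin (2 * 4)) (Fin (2 * 4)) ℝ, D.IsSymm ∧ D * weilJ 4 = weilJ 4 * D ∧ ℓ D ≠ 0) ∧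
      ∀ Q' : Matrix (Fin (2 * 4)) (Fin (2 * 4)) ℝ, Q'.IsSymm → Q' * weilJ 4 = weilJ 4 * Q' →
        (∃ Z' : TropicalTorusCycle (2 * 4) 4 Q',
          ∃ (hc : Z'.numCells = Z₀.numCells) (hf : Z'.numFacetClasses = Z₀.numFacetClasses),
            ∀ σ : Fin Z'.numCells,
              (Z'.cell σ).weight = (Z₀.cell (Fin.cast hc σ)).weight ∧
              (Z'.cell σ).frame = (Z₀.cell (Fin.cast hc σ)).frame ∧
              ∀ i : Fin (4 + 1),
                Fin.cast hf (Z'.facetClass σ i) = Z₀.facetClass (Fin.cast hc σ) i ∧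
                Z'.facetPerm σ i = Z₀.facetPerm (Fin.cast hc σ) i ∧
                Z'.facetShift σ i = Z₀.facetShift (Fin.cast hc σ) i) → ℓ Q' = 0 := by
  rcases obstructed_or_linearSection Z₀ with hobs | hsec
  · exact hobs
  · exfalso
    have h := (numCells_ge_of_linearlyRealisable Z₀ hZ₀ hsec).1
    omega

/-- **Obstruction by rank of the frame span** (the sharpest form; "at most `68` distinct `4`-planes, orientations ignored"):
a non-empty effective tropical `4`-cycle on `ℝ⁸/ℤ⁸` whose Plücker vectors span a subspace of dimension `≤ 68` is obstructed at
the identity. [cite: Zharkov2020TropicalWeil, §1–2 (pp. 2–4)] [cite: MikhalkinZharkov2014Eigenwave, Def. 4.2 and Prop. 4.3] -/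
theorem obstructed_of_finrank_span_frames_le
    (Z₀ : TropicalTorusCycle (2 * 4) 4 (1 : Matrix (Fin (2 * 4)) (Fin (2 * 4)) ℝ)) (hZ₀ : 0 < Z₀.numCells)
    (hfew : Module.finrank ℝ (Submodule.span ℝ (Set.range fun σ : Fin Z₀.numCells =>
      fun S : Fin 4 → Fin (2 * 4) => ((pluckerCoord (Z₀.cell σ).frame S : ℤ) : ℝ))) ≤ 68) :
    ∃ ℓ : Matrix (Fin (2 * 4)) (Fin (2 * 4)) ℝ →ₗ[ℝ] ℝ,
      (∃ D : Matrix (Fin (2 * 4)) (Fin (2 * 4)) ℝ, D.IsSymm ∧ D * weilJ 4 = weilJ 4 * D ∧ ℓ D ≠ 0) ∧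
      ∀ Q' : Matrix (Fin (2 * 4)) (Fin (2 * 4)) ℝ, Q'.IsSymm → Q' * weilJ 4 = weilJ 4 * Q' →
        (∃ Z' : TropicalTorusCycle (2 * 4) 4 Q',
          ∃ (hc : Z'.numCells = Z₀.numCells) (hf : Z'.numFacetClasses = Z₀.numFacetClasses),
            ∀ σ : Fin Z'.numCells,
              (Z'.cell σ).weight = (Z₀.cell (Fin.cast hc σ)).weight ∧
              (Z'.cell σ).frame = (Z₀.cell (Fin.cast hc σ)).frame ∧
              ∀ i : Fin (4 + 1),
                Fin.cast hf (Z'.facetClass σ i) = Z₀.facetClass (Fin.cast hc σ) i ∧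
                Z'.facetPerm σ i = Z₀.facetPerm (Fin.cast hc σ) i ∧
                Z'.facetShift σ i = Z₀.facetShift (Fin.cast hc σ) i) → ℓ Q' = 0 := by
  rcases obstructed_or_linearSection Z₀ with hobs | hsec
  · exact hobs
  · exfalso
    have h := finrank_span_frames_ge_of_linearlyRealisable Z₀ hZ₀ hsec
    omega

/-- **Obstruction by cell count:** a non-empty effective tropical `4`-cycle on `ℝ⁸/ℤ⁸` with at most `68` cells is obstructed
at the identity (same conclusion). [cite: Zharkov2020TropicalWeil, §1–2 (pp. 2–4)]
[cite: MikhalkinZharkov2014Eigenwave, Def. 4.2 and Prop. 4.3] -/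
theorem obstructed_of_numCells_le
    (Z₀ : TropicalTorusCycle (2 * 4) 4 (1 : Matrix (Fin (2 * 4)) (Fin (2 * 4)) ℝ)) (hZ₀ : 0 < Z₀.numCells)
    (hfew : Z₀.numCells ≤ 68) :
    ∃ ℓ : Matrix (Fin (2 * 4)) (Fin (2 * 4)) ℝ →ₗ[ℝ] ℝ,
      (∃ D : Matrix (Fin (2 * 4)) (Fin (2 * 4)) ℝ, D.IsSymm ∧ D * weilJ 4 = weilJ 4 * D ∧ ℓ D ≠ 0) ∧
      ∀ Q' : Matrix (Fin (2 * 4)) (Fin (2 * 4)) ℝ, Q'.IsSymm → Q' * weilJ 4 = weilJ 4 * Q' →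
        (∃ Z' : TropicalTorusCycle (2 * 4) 4 Q',
          ∃ (hc : Z'.numCells = Z₀.numCells) (hf : Z'.numFacetClasses = Z₀.numFacetClasses),
            ∀ σ : Fin Z'.numCells,
              (Z'.cell σ).weight = (Z₀.cell (Fin.cast hc σ)).weight ∧
              (Z'.cell σ).frame = (Z₀.cell (Fin.cast hc σ)).frame ∧
              ∀ i : Fin (4 + 1),
                Fin.cast hf (Z'.facetClass σ i) = Z₀.facetClass (Fin.cast hc σ) i ∧
                Z'.facetPerm σ i = Z₀.facetPerm (Fin.cast hc σ) i ∧
                Z'.facetShift σ i = Z₀.facetShift (Fin.cast hc σ) i) → ℓ Q' = 0 := by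
  classical
  refine obstructed_of_card_image_pluckerCoord_le Z₀ hZ₀ ?_
  have h2 := Finset.card_image_le (s := (Finset.univ : Finset (Fin Z₀.numCells)))
    (f := fun σ : Fin Z₀.numCells => pluckerCoord (Z₀.cell σ).frame)
  simp only [Finset.card_univ, Fintype.card_fin] at h2
  omega

/-- A cycle with non-zero Weil functional has a cell. [cite: Zharkov2020TropicalWeil, §2] -/
theorem numCells_pos_of_weilFunctional_ne_zero {n : ℕ} {Q : Matrix (Fin (2 * n)) (Fin (2 * n)) ℝ}
    (Z : TropicalTorusCycle (2 * n) n Q) (hW : weilFunctional Z ≠ 0) : 0 < Z.numCells := by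
  refine Nat.pos_of_ne_zero fun h0 => hW ?_
  have : IsEmpty (Fin Z.numCells) := ⟨fun σ => by have := σ.isLt; omega⟩
  unfold weilFunctional
  exact Finset.sum_eq_zero fun σ _ => (IsEmpty.false σ).elim

/-- **K1 ⟺ every LARGE `W ≠ 0` seed is obstructed.** The open crux `TropicalWeilVanishing` holds iff every effective
tropical `4`-cycle `Z₀` on `ℝ⁸/ℤ⁸` with `W(Z₀) ≠ 0` AND frame span of rank `≥ 69` is obstructed at the identity
(`tropicalWeilVanishing_iff_obstructedAtIdentity`, p314377, with the small types discharged by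
`obstructed_of_finrank_span_frames_le`): the open content of K1 lives entirely on types with at least `69` distinct
`4`-planes. Nothing here decides K1. [cite: Zharkov2020TropicalWeil, §1–2 (pp. 2–4)]
[cite: MikhalkinZharkov2014Eigenwave, Def. 4.2 and Prop. 4.3] -/
theorem tropicalWeilVanishing_iff_obstructed_of_large
    : Theses.TropicalWeilObstruction.TropicalWeilVanishing ↔
      ∀ Z₀ : TropicalTorusCycle (2 * 4) 4 (1 : Matrix (Fin (2 * 4)) (Fin (2 * 4)) ℝ),
        weilFunctional Z₀ ≠ 0 →
        69 ≤ Module.finrank ℝ (Submodule.span ℝ (Set.range fun σ : Fin Z₀.numCells =>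
          fun S : Fin 4 → Fin (2 * 4) => ((pluckerCoord (Z₀.cell σ).frame S : ℤ) : ℝ))) →
        ∃ ℓ : Matrix (Fin (2 * 4)) (Fin (2 * 4)) ℝ →ₗ[ℝ] ℝ,
          (∃ D : Matrix (Fin (2 * 4)) (Fin (2 * 4)) ℝ, D.IsSymm ∧
            D * weilJ 4 = weilJ 4 * D ∧ ℓ D ≠ 0) ∧
          ∀ Q' : Matrix (Fin (2 * 4)) (Fin (2 * 4)) ℝ, Q'.IsSymm → Q' * weilJ 4 = weilJ 4 * Q' →
            (∃ Z' : TropicalTorusCycle (2 * 4) 4 Q',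
              ∃ (hc : Z'.numCells = Z₀.numCells) (hf : Z'.numFacetClasses = Z₀.numFacetClasses),
                ∀ σ : Fin Z'.numCells,
                  (Z'.cell σ).weight = (Z₀.cell (Fin.cast hc σ)).weight ∧
                  (Z'.cell σ).frame = (Z₀.cell (Fin.cast hc σ)).frame ∧
                  ∀ i : Fin (4 + 1),
                    Fin.cast hf (Z'.facetClass σ i) = Z₀.facetClass (Fin.cast hc σ) i ∧
                    Z'.facetPerm σ i = Z₀.facetPerm (Fin.cast hc σ) i ∧
                    Z'.facetShift σ i = Z₀.facetShift (Fin.cast hc σ) i) → ℓ Q' = 0 := by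
  rw [tropicalWeilVanishing_iff_obstructedAtIdentity]
  constructor
  · intro h Z₀ hW _
    exact h Z₀ hW
  · intro h Z₀ hW
    by_cases hr : 69 ≤ Module.finrank ℝ (Submodule.span ℝ (Set.range fun σ : Fin Z₀.numCells =>
        fun S : Fin 4 → Fin (2 * 4) => ((pluckerCoord (Z₀.cell σ).frame S : ℤ) : ℝ)))
    · exact h Z₀ hW hr
    · exact obstructed_of_finrank_span_frames_le Z₀ (numCells_pos_of_weilFunctional_ne_zero Z₀ hW) (by omega)

end Summit.HodgeConjecture.HodgeConjecture.Theorems.TropicalWeilVanishing.FrameSpan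

end
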